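import Summits.CriticalPhenomena.PercolationContinuityZ3.Theorems.Transplant.FKConnectivityAllQForestAdjacentPathGadgetMoves
import Summits.CriticalPhenomena.PercolationContinuityZ3.Theorems.Transplant.FKConnectivityAllQForestAdjacentPathGadgetFacts
import HarnessLib

/-!
# The path gadget: the second involution `Ψ` on the residual colourings (gadget pair `op` in the first class)

builds on p205010 (kernel theorem, internal audit signed; external expert review pending).  No definitions, no named facts, no sorries;
standard axioms.

Separator `S = {o, p, q}` of `v` from `y` whose gadget is the PATH `{op, oq}` (both pairs free in the fibre, `pq` absent; sides `E₁ ∋ e`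
on `V₁`, `E₂ ∋ f` on `V₂`, `V₁ ∩ V₂ ⊆ S`, no side pair inside `S`).  By `…SeparatorResidual`, `bad − good = bad_R − good_R` with `R` the
RESIDUAL colourings (both sides trace-asymmetric).  Here (memo bschramm/FROM-fk-1-g20-SEPARATOR-EXCHANGE.md §3): on `R` the map
`Ψ` = "recolour side 2 by its partner AND move the one gadget pair that keeps both classes forests" is a validity-preserving,
fibre-preserving involution on `R` minus the DOUBLY-`pq` colourings `Res = {pq joined on both sides in opposite classes}`, fixes side 1
and flips the free pairs of side 2; hence (`adjForestNoSq_fibre_pathGadget_residual`) `bad_R + good_Res = good_R + bad_Res`, and with the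
residual theorem `bad + good_Res = good + bad_Res`: the node's inequality across a path-gadget separator is EQUIVALENT to
`bad_Res ≤ good_Res`, where `Res` consists of the four product classes `(d,pq | pq,d)`, `(pq,d | d,pq)` × (two gadget orientations) — the
kernel form of the rank-one identity `bad − good = −2·x₁(d,pq)·x₂(d,pq)` up to the product decomposition of `Res`.
* **`forest_pair_pathGadget_transfer_of_mem`** — `Ψ` pointwise (case `op ∈ ω`): valid ↦ valid, involution, fibre/side-1 preserved, side 2 flipped, `R` and
  `Resᶜ` preserved (validity by the two moves of `…PathGadgetMoves`).  The count identity is `…PathGadgetResidual`.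
[cite: Grimmett2006, §1.5 (p. 13); §3.8 (pp. 61–62); §4.2 Lemma (4.13)] [cite: SempleWelsh2008, Conj. 1.1 (p. 2)] [cite: Linusson2011, Prop. 2.6]
-/

noncomputable section

namespace Summit.CriticalPhenomena.PercolationContinuityZ3.Theorems

namespace FK

open Set SimpleGraph Literature.Probability.LatticeModels Literature.Probability.Percolation
open scoped Classical

variable {V : Type*} [Fintype V]

section PathGadget

open scoped symmDiff

variable {E₁ E₂ : Set (Sym2 V)} {V₁ V₂ : Set V} {M u₀ : BondConfig V} {o p q v y : V}

/-- **The second involution `Ψ` on the residual colourings of a path-gadget separator, case `op ∈ ω`** (memo §3).  Geometry: `S = {o, p, q}` pairwise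
distinct, sides `E₁` (on `V₁`), `E₂` (on `V₂`), `V₁ ∩ V₂ ⊆ S`, `E₁ ∩ E₂ = ∅`, no side pair inside `S`; the fibre `(M', u₀)` lies in
`{op, oq} ∪ E₁ ∪ E₂` and both gadget pairs are FREE (`op, oq ∈ M'`).  For a valid colouring `ω` write `A₁ = ω ∩ E₁`, `A₂ = ω ∩ E₂`,
`B₁ = (ω ∆ M') ∩ E₁`, `B₂ = (ω ∆ M') ∩ E₂`.  `Ψ` recolours side 2 by its partner and moves ONE gadget pair:
gadget `⊆ ω`: move `oq` out if `¬ o ~_{B₁} q ∧ ¬ o ~_{B₂} p`, else move `op` out; gadget `∩ ω = ∅`: move `op` in if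
`¬ o ~_{A₁} p ∧ ¬ o ~_{A₂} q`, else move `oq` in; `op ∈ ω ∌ oq`: move `oq` in if `A₁` is discrete on `S`, else move `op` out;
`oq ∈ ω ∌ op`: move `op` in if `A₁` is discrete, else move `oq` out.  If `ω` is RESIDUAL (both sides trace-asymmetric) and not
DOUBLY-`pq` (`pq` not joined on both sides in opposite classes), then `Ψ ω` is a valid colouring of the same fibre, again residual and
not doubly-`pq`, `Ψ (Ψ ω) = ω`, side 1 is kept and the free pairs of side 2 are flipped. [cite: Grimmett2006, §3.8 (pp. 61–62); §4.2 Lemma (4.13)] [cite: Linusson2011, Prop. 2.6] -/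
theorem forest_pair_pathGadget_transfer_of_mem (hop : o ≠ p) (hoq : o ≠ q) (hpq : p ≠ q)
    (h₁ : ∀ e ∈ E₁, ∀ z ∈ e, z ∈ V₁) (h₂ : ∀ e ∈ E₂, ∀ z ∈ e, z ∈ V₂) (hS : V₁ ∩ V₂ ⊆ ({o, p, q} : Set V))
    (hd : Disjoint E₁ E₂) (hn₁ : ∀ x ∈ ({o, p, q} : Set V), ∀ x' ∈ ({o, p, q} : Set V), s(x, x') ∉ E₁)
    (hn₂ : ∀ x ∈ ({o, p, q} : Set V), ∀ x' ∈ ({o, p, q} : Set V), s(x, x') ∉ E₂)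
    {M' : BondConfig V} (hM' : M' ∪ u₀ ⊆ ({s(o, p), s(o, q)} : Set (Sym2 V)) ∪ (E₁ ∪ E₂)) (hgp : s(o, p) ∈ M') (hgq : s(o, q) ∈ M')
    (Ψ : BondConfig V → BondConfig V)
    (hΨ : ∀ ω, Ψ ω =
      if s(o, p) ∈ ω then
        (if s(o, q) ∈ ω then
          (if ¬ (openGraph ((ω ∆ M') ∩ E₁)).Reachable o q ∧ ¬ (openGraph ((ω ∆ M') ∩ E₂)).Reachable o p
            then ω ∆ (M' ∩ E₂ ∪ {s(o, q)}) else ω ∆ (M' ∩ E₂ ∪ {s(o, p)}))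
        else
          (if ∀ x ∈ ({o, p, q} : Set V), ∀ x' ∈ ({o, p, q} : Set V), (openGraph (ω ∩ E₁)).Reachable x x' → x = x'
            then ω ∆ (M' ∩ E₂ ∪ {s(o, q)}) else ω ∆ (M' ∩ E₂ ∪ {s(o, p)})))
      else
        (if s(o, q) ∈ ω then
          (if ∀ x ∈ ({o, p, q} : Set V), ∀ x' ∈ ({o, p, q} : Set V), (openGraph (ω ∩ E₁)).Reachable x x' → x = x'
            then ω ∆ (M' ∩ E₂ ∪ {s(o, p)}) else ω ∆ (M' ∩ E₂ ∪ {s(o, q)}))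
        else
          (if ¬ (openGraph (ω ∩ E₁)).Reachable o p ∧ ¬ (openGraph (ω ∩ E₂)).Reachable o q
            then ω ∆ (M' ∩ E₂ ∪ {s(o, p)}) else ω ∆ (M' ∩ E₂ ∪ {s(o, q)}))))
    {ω : BondConfig V} (hω : ω \ M' = u₀) (hF : IsForestCfg ω) (hFB : IsForestCfg (ω ∆ M'))
    (hR₁ : ¬ ∀ x ∈ ({o, p, q} : Set V), ∀ x' ∈ ({o, p, q} : Set V),
      (openGraph (ω ∩ E₁)).Reachable x x' ↔ (openGraph ((ω ∆ M') ∩ E₁)).Reachable x x')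
    (hR₂ : ¬ ∀ x ∈ ({o, p, q} : Set V), ∀ x' ∈ ({o, p, q} : Set V),
      (openGraph (ω ∩ E₂)).Reachable x x' ↔ (openGraph ((ω ∆ M') ∩ E₂)).Reachable x x')
    (hnRes : ¬ (((openGraph (ω ∩ E₂)).Reachable p q ∧ (openGraph ((ω ∆ M') ∩ E₁)).Reachable p q) ∨
      ((openGraph (ω ∩ E₁)).Reachable p q ∧ (openGraph ((ω ∆ M') ∩ E₂)).Reachable p q)))
    (hp : s(o, p) ∈ ω) :
    Ψ ω \ M' = u₀ ∧ IsForestCfg (Ψ ω) ∧ IsForestCfg ((Ψ ω) ∆ M') ∧ Ψ (Ψ ω) = ω ∧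
      (∀ x ∈ E₁, x ∈ Ψ ω ↔ x ∈ ω) ∧ (∀ x ∈ M', x ∈ E₂ → (x ∈ Ψ ω ↔ x ∉ ω)) ∧
      (¬ ∀ x ∈ ({o, p, q} : Set V), ∀ x' ∈ ({o, p, q} : Set V),
        (openGraph ((Ψ ω) ∩ E₁)).Reachable x x' ↔ (openGraph (((Ψ ω) ∆ M') ∩ E₁)).Reachable x x') ∧
      (¬ ∀ x ∈ ({o, p, q} : Set V), ∀ x' ∈ ({o, p, q} : Set V),
        (openGraph ((Ψ ω) ∩ E₂)).Reachable x x' ↔ (openGraph (((Ψ ω) ∆ M') ∩ E₂)).Reachable x x') ∧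
      ¬ (((openGraph ((Ψ ω) ∩ E₂)).Reachable p q ∧ (openGraph (((Ψ ω) ∆ M') ∩ E₁)).Reachable p q) ∨
        ((openGraph ((Ψ ω) ∩ E₁)).Reachable p q ∧ (openGraph (((Ψ ω) ∆ M') ∩ E₂)).Reachable p q)) := by
  -- ### notation and bookkeeping
  set S3 : Set V := {o, p, q} with hS3
  set ES : Set (Sym2 V) := {s(o, p), s(o, q)} with hESdef
  set N₀ : BondConfig V := M' ∩ E₂ with hN₀
  set A₁ : BondConfig V := ω ∩ E₁ with hA₁
  set A₂ : BondConfig V := ω ∩ E₂ with hA₂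
  set B₁ : BondConfig V := (ω ∆ M') ∩ E₁ with hB₁
  set B₂ : BondConfig V := (ω ∆ M') ∩ E₂ with hB₂
  have ho3 : o ∈ S3 := mem_insert _ _
  have hp3 : p ∈ S3 := mem_insert_of_mem _ (mem_insert _ _)
  have hq3 : q ∈ S3 := mem_insert_of_mem _ (mem_insert_of_mem _ rfl)
  obtain ⟨hpoq, hqop, hoqp, hpqo⟩ := triple_perm o p q
  have memES : ∀ x ∈ ES, x = s(o, p) ∨ x = s(o, q) := by
    rintro x (hx | hx)
    · exact Or.inl hx
    · exact Or.inr (mem_singleton_iff.1 hx)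
  have hES₁ : Disjoint ES E₁ := pathGadget_disjoint_of_noPair hn₁
  have hES₂ : Disjoint ES E₂ := pathGadget_disjoint_of_noPair hn₂
  have hE : ∀ x, x ∈ E₁ → x ∉ E₂ := fun x hx1 hx2 => Set.disjoint_left.1 hd hx1 hx2
  have hM'sub : M' ⊆ ES ∪ (E₁ ∪ E₂) := fun x hx => hM' (Or.inl hx)
  have hωsub : ω ⊆ ES ∪ (E₁ ∪ E₂) := fun x hx => by
    by_cases hxM : x ∈ M'
    · exact hM'sub hxM
    · exact hM' (Or.inr (hω ▸ ⟨hx, hxM⟩))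
  -- gadget pairs: free, hence in exactly one class
  have hgpB : s(o, p) ∈ ω ∆ M' ↔ s(o, p) ∉ ω := mem_symmDiff_iff_of_mem hgp
  have hgqB : s(o, q) ∈ ω ∆ M' ↔ s(o, q) ∉ ω := mem_symmDiff_iff_of_mem hgq
  have inB : ∀ x ∈ ES, (x ∈ ω ∆ M' ↔ x ∉ ω) := by
    intro x hx
    rcases memES x hx with rfl | rfl
    · exact hgpB
    · exact hgqB
  have hne_pq : s(o, p) ≠ s(o, q) := fun h => by
    rcases Sym2.eq_iff.1 h with ⟨-, h⟩ | ⟨h, -⟩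
    · exact hpq h
    · exact hoq h
  -- ### no double joins with a gadget pair
  have ndj : ∀ {X : BondConfig V} {E : Set (Sym2 V)} {x x' : V}, IsForestCfg X → x ≠ x' → s(x, x') ∈ X →
      x ∈ S3 → x' ∈ S3 → (E = E₁ ∨ E = E₂) → ¬ (openGraph (X ∩ E)).Reachable x x' := by
    intro X E x x' hX hne hg hx hx' hEE
    refine not_reachable_inter_of_mem hX hne hg ?_
    rcases hEE with rfl | rfl
    · exact hn₁ x hx x' hx'
    · exact hn₂ x hx x' hx'
  have three : ∀ {X : BondConfig V} {x x' r r' : V}, IsForestCfg X → x ∈ S3 → x' ∈ S3 → r ∈ S3 → r' ∈ S3 → x ≠ x' → r ≠ r' →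
      (openGraph (X ∩ E₁)).Reachable x x' → (openGraph (X ∩ E₂)).Reachable r r' → ∀ g ∈ ES, g ∉ X :=
    fun hX hx hx' hr hr' hne hne' hj₁ hj₂ => pathGadget_no_two_joins hop hoq hpq hd hn₁ hn₂ hX hx hx' hr hr' hne hne' hj₁ hj₂
  -- two discrete traces agree
  have agree : ∀ {Z Z' : BondConfig V}, (∀ x ∈ S3, ∀ x' ∈ S3, (openGraph Z).Reachable x x' → x = x') →
      (∀ x ∈ S3, ∀ x' ∈ S3, (openGraph Z').Reachable x x' → x = x') →
      ∀ x ∈ S3, ∀ x' ∈ S3, (openGraph Z).Reachable x x' ↔ (openGraph Z').Reachable x x' := by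
    intro Z Z' hZ hZ' x hx x' hx'
    exact ⟨fun h => by rw [hZ x hx x' hx' h], fun h => by rw [hZ' x hx x' hx' h]⟩
  have nondisc : ∀ {Z : BondConfig V}, ¬ (∀ x ∈ S3, ∀ x' ∈ S3, (openGraph Z).Reachable x x' → x = x') →
      ∃ x ∈ S3, ∃ x' ∈ S3, x ≠ x' ∧ (openGraph Z).Reachable x x' := by
    intro Z h
    by_contra h'
    exact h fun x hx x' hx' hxx' => by_contra fun hne => h' ⟨x, hx, x', hx', hne, hxx'⟩
  have notall : ∀ {X : BondConfig V} {E E' : Set (Sym2 V)} {x x' : V}, IsForestCfg X → Disjoint E E' →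
      (openGraph (X ∩ E)).Reachable o p → (openGraph (X ∩ E)).Reachable o q → x ∈ S3 → x' ∈ S3 → x ≠ x' →
      ¬ (openGraph (X ∩ E')).Reachable x x' :=
    fun hX hEE' hop' hoq' hx hx' hne => not_reachable_of_joins_all hX hEE' hop' hoq' hx hx' hne
  -- ### the generic part of the conclusion, for `K = N₀ ∪ G`, `G ⊆ ES`
  have generic : ∀ (G : Set (Sym2 V)), G ⊆ ES →
      (ω ∆ (N₀ ∪ G)) \ M' = u₀ ∧ (ω ∆ (N₀ ∪ G)) ∩ E₁ = A₁ ∧ (ω ∆ (N₀ ∪ G)) ∩ E₂ = B₂ ∧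
      ((ω ∆ (N₀ ∪ G)) ∆ M') ∩ E₁ = B₁ ∧ ((ω ∆ (N₀ ∪ G)) ∆ M') ∩ E₂ = A₂ ∧
      (∀ x ∈ E₁, x ∈ ω ∆ (N₀ ∪ G) ↔ x ∈ ω) ∧ (∀ x ∈ M', x ∈ E₂ → (x ∈ ω ∆ (N₀ ∪ G) ↔ x ∉ ω)) ∧
      (ω ∆ (N₀ ∪ G)) ∆ (N₀ ∪ G) = ω := by
    intro G hG
    have hGM : G ⊆ M' := fun g hg => by
      rcases hG hg with rfl | h
      · exact hgp
      · rw [mem_singleton_iff.1 h]; exact hgq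
    exact pathGadget_toggle_bookkeeping hω hG hGM hES₁ hd
  -- validity from the two glued descriptions
  -- ### generic moves
  have hAdisj : Disjoint A₁ A₂ := Set.disjoint_of_subset inter_subset_right inter_subset_right hd
  have hBdisj : Disjoint B₁ B₂ := Set.disjoint_of_subset inter_subset_right inter_subset_right hd
  -- the residual structure is kept by any toggle `K = N₀ ∪ G`
  have keepR : ∀ (G : Set (Sym2 V)), G ⊆ ES →
      (¬ ∀ x ∈ S3, ∀ x' ∈ S3, (openGraph ((ω ∆ (N₀ ∪ G)) ∩ E₁)).Reachable x x' ↔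
          (openGraph (((ω ∆ (N₀ ∪ G)) ∆ M') ∩ E₁)).Reachable x x') ∧
      (¬ ∀ x ∈ S3, ∀ x' ∈ S3, (openGraph ((ω ∆ (N₀ ∪ G)) ∩ E₂)).Reachable x x' ↔
          (openGraph (((ω ∆ (N₀ ∪ G)) ∆ M') ∩ E₂)).Reachable x x') ∧
      ¬ (((openGraph ((ω ∆ (N₀ ∪ G)) ∩ E₂)).Reachable p q ∧ (openGraph (((ω ∆ (N₀ ∪ G)) ∆ M') ∩ E₁)).Reachable p q) ∨
        ((openGraph ((ω ∆ (N₀ ∪ G)) ∩ E₁)).Reachable p q ∧ (openGraph (((ω ∆ (N₀ ∪ G)) ∆ M') ∩ E₂)).Reachable p q)) := by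
    intro G hG
    obtain ⟨-, hT1, hT2, hT3, hT4, -, -, -⟩ := generic G hG
    rw [hT1, hT2, hT3, hT4]
    refine ⟨hR₁, fun h => hR₂ (trace_iff_comm.1 h), ?_⟩
    rintro (⟨h1, h2⟩ | ⟨h1, h2⟩)
    · exact not_reachable_of_disjoint_join hFB inter_subset_left inter_subset_left hBdisj.symm hpq h2 h1
    · exact not_reachable_of_disjoint_join hF inter_subset_left inter_subset_left hAdisj.symm hpq h1 h2
  -- how to conclude once the toggle, its validity and its self-inverse evaluation are known
  have finish : ∀ (G : Set (Sym2 V)), G ⊆ ES → Ψ ω = ω ∆ (N₀ ∪ G) →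
      IsForestCfg (ω ∆ (N₀ ∪ G)) ∧ IsForestCfg ((ω ∆ (N₀ ∪ G)) ∆ M') →
      Ψ (ω ∆ (N₀ ∪ G)) = (ω ∆ (N₀ ∪ G)) ∆ (N₀ ∪ G) →
      Ψ ω \ M' = u₀ ∧ IsForestCfg (Ψ ω) ∧ IsForestCfg ((Ψ ω) ∆ M') ∧ Ψ (Ψ ω) = ω ∧
      (∀ x ∈ E₁, x ∈ Ψ ω ↔ x ∈ ω) ∧ (∀ x ∈ M', x ∈ E₂ → (x ∈ Ψ ω ↔ x ∉ ω)) ∧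
      (¬ ∀ x ∈ S3, ∀ x' ∈ S3,
        (openGraph ((Ψ ω) ∩ E₁)).Reachable x x' ↔ (openGraph (((Ψ ω) ∆ M') ∩ E₁)).Reachable x x') ∧
      (¬ ∀ x ∈ S3, ∀ x' ∈ S3,
        (openGraph ((Ψ ω) ∩ E₂)).Reachable x x' ↔ (openGraph (((Ψ ω) ∆ M') ∩ E₂)).Reachable x x') ∧
      ¬ (((openGraph ((Ψ ω) ∩ E₂)).Reachable p q ∧ (openGraph (((Ψ ω) ∆ M') ∩ E₁)).Reachable p q) ∨
        ((openGraph ((Ψ ω) ∩ E₁)).Reachable p q ∧ (openGraph (((Ψ ω) ∆ M') ∩ E₂)).Reachable p q)) := by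
    intro G hG hΨω hval hΨΨ
    obtain ⟨hfib, -, -, -, -, hE1, hE2, hinv⟩ := generic G hG
    obtain ⟨k1, k2, k3⟩ := keepR G hG
    rw [hΨω]
    exact ⟨hfib, hval.1, hval.2, by rw [hΨΨ, hinv], hE1, hE2, k1, k2, k3⟩
  -- membership of the gadget pairs after a toggle
  have memK : ∀ (G : Set (Sym2 V)) (g : Sym2 V), g ∈ ES → (g ∈ ω ∆ (N₀ ∪ G) ↔ (g ∈ ω ↔ g ∉ G)) := by
    intro G g hg
    have hgN : g ∉ N₀ := fun h => Set.disjoint_left.1 hES₂ hg h.2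
    by_cases hgG : g ∈ G
    · rw [mem_symmDiff_iff_of_mem (Or.inr hgG)]
      exact ⟨fun h => ⟨fun hω => absurd hω h, fun hG' => absurd hgG hG'⟩, fun h hω => (h.1 hω) hgG⟩
    · rw [mem_symmDiff_iff_of_notMem (fun h => h.elim hgN hgG)]
      exact ⟨fun h => ⟨fun _ => hgG, fun _ => h⟩, fun h => h.2 hgG⟩
  have hopES : s(o, p) ∈ ES := mem_insert _ _
  have hoqES : s(o, q) ∈ ES := mem_insert_of_mem _ rfl
  have subp : ({s(o, p)} : Set (Sym2 V)) ⊆ ES := singleton_subset_iff.2 hopES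
  have subq : ({s(o, q)} : Set (Sym2 V)) ⊆ ES := singleton_subset_iff.2 hoqES
  -- ### case analysis on the gadget colouring
  by_cases hq : s(o, q) ∈ ω
  · -- gadget ⊆ `A`: `A₁, A₂` discrete, `B₁, B₂` non-discrete
    have hA₁d : ∀ x ∈ S3, ∀ x' ∈ S3, (openGraph A₁).Reachable x x' → x = x' :=
      sep_inter_of_two_pairs hop hoq hpq hF hp hq (hn₁ o ho3 p hp3) (hn₁ o ho3 q hq3)
    have hA₂d : ∀ x ∈ S3, ∀ x' ∈ S3, (openGraph A₂).Reachable x x' → x = x' :=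
      sep_inter_of_two_pairs hop hoq hpq hF hp hq (hn₂ o ho3 p hp3) (hn₂ o ho3 q hq3)
    have hB₁n : ¬ ∀ x ∈ S3, ∀ x' ∈ S3, (openGraph B₁).Reachable x x' → x = x' := fun h => hR₁ (agree hA₁d h)
    have hB₂n : ¬ ∀ x ∈ S3, ∀ x' ∈ S3, (openGraph B₂).Reachable x x' → x = x' := fun h => hR₂ (agree hA₂d h)
    have hpB : s(o, p) ∉ ω ∆ M' := fun h => hgpB.1 h hp
    have hqB : s(o, q) ∉ ω ∆ M' := fun h => hgqB.1 h hq
    -- subset facts for `valid_of` when `oc` leaves `A`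
    have subsA : ∀ {g g' : Sym2 V}, ES = {g, g'} ∨ ES = {g', g} → g ≠ g' → g ∈ ω → g' ∉ ω ∆ M' →
        (ω ∆ {g}) ∩ ES ⊆ {g'} ∧ ((ω ∆ M') ∆ {g}) ∩ ES ⊆ {g} := by
      intro g g' hESgg hgg hgω hg'B
      obtain ⟨hGA, -⟩ := gadget_toggle_subset (X := ω) hESgg hgg
      obtain ⟨-, hGB⟩ := gadget_toggle_subset (X := ω ∆ M') hESgg hgg
      have hgB : g ∉ ω ∆ M' := by
        have : g ∈ ES := by
          rcases hESgg with h | h <;> rw [h]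
          · exact mem_insert _ _
          · exact mem_insert_of_mem _ rfl
        exact fun h => (inB _ this).1 h hgω
      exact ⟨fun x hx => (hGA hgω hx).1, fun x hx => by
        rcases hGB hgB hx with hx' | ⟨hx', hg'⟩
        · exact hx'
        · exact absurd hg' hg'B⟩
    by_cases hc : ¬ (openGraph ((ω ∆ M') ∩ E₁)).Reachable o q ∧ ¬ (openGraph ((ω ∆ M') ∩ E₂)).Reachable o p
    · -- move `oq` out of `A`
      have hΨω : Ψ ω = ω ∆ (N₀ ∪ {s(o, q)}) := by rw [hΨ ω, if_pos hp, if_pos hq, if_pos hc]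
      obtain ⟨sA, sB⟩ := subsA (Or.inr rfl) hne_pq.symm hq hpB
      have hval := isForestCfg_toggle_of_glued hM'sub hωsub hES₁ hES₂ hd {s(o, q)} subq sA sB
        (pathGadget_moveGen hop hoq hpq h₁ h₂ hS hd hn₁ hn₂ hF hFB rfl hoq hop hpq hq3 hp3 hoqES hopES hA₁d hA₂d hc.1 hc.2).1
        (pathGadget_moveGen hop hoq hpq h₁ h₂ hS hd hn₁ hn₂ hF hFB rfl hoq hop hpq hq3 hp3 hoqES hopES hA₁d hA₂d hc.1 hc.2).2
      refine finish {s(o, q)} subq hΨω hval ?_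
      obtain ⟨-, hT1, -, -, -, -, -, -⟩ := generic {s(o, q)} subq
      have hp' : s(o, p) ∈ ω ∆ (N₀ ∪ {s(o, q)}) := (memK _ _ hopES).2 (iff_of_true hp fun h => hne_pq (mem_singleton_iff.1 h))
      have hq' : s(o, q) ∉ ω ∆ (N₀ ∪ {s(o, q)}) := fun h => ((memK _ _ hoqES).1 h).1 hq (mem_singleton _)
      have hd' : ∀ x ∈ S3, ∀ x' ∈ S3, (openGraph ((ω ∆ (N₀ ∪ {s(o, q)})) ∩ E₁)).Reachable x x' → x = x' := by
        rw [hT1]; exact hA₁d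
      rw [hΨ (ω ∆ (N₀ ∪ {s(o, q)})), if_pos hp', if_neg hq', if_pos hd']
    · -- move `op` out of `A`; the needed facts follow from the failed condition
      have hΨω : Ψ ω = ω ∆ (N₀ ∪ {s(o, p)}) := by rw [hΨ ω, if_pos hp, if_pos hq, if_neg hc]
      have hfacts : ¬ (openGraph B₁).Reachable o p ∧ ¬ (openGraph B₂).Reachable o q := by
        rw [not_and_or, not_not, not_not] at hc
        obtain ⟨x, hx, x', hx', hxx', hB₁j⟩ := nondisc hB₁n
        obtain ⟨r, hr, r', hr', hrr', hB₂j⟩ := nondisc hB₂n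
        rcases hc with hB₁oq | hB₂op
        · refine ⟨fun hB₁op => ?_, fun hB₂oq => ?_⟩
          · exact notall hFB hd hB₁op hB₁oq hr hr' hrr' hB₂j
          · exact not_reachable_of_disjoint_join hFB inter_subset_left inter_subset_left hBdisj hoq hB₂oq hB₁oq
        · refine ⟨fun hB₁op => ?_, fun hB₂oq => ?_⟩
          · exact not_reachable_of_disjoint_join hFB inter_subset_left inter_subset_left hBdisj hop hB₂op hB₁op
          · exact notall hFB hd.symm hB₂op hB₂oq hx hx' hxx' hB₁j
      obtain ⟨sA, sB⟩ := subsA (Or.inl rfl) hne_pq hp hqB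
      have hval := isForestCfg_toggle_of_glued hM'sub hωsub hES₁ hES₂ hd {s(o, p)} subp sA sB
        (pathGadget_moveGen hop hoq hpq h₁ h₂ hS hd hn₁ hn₂ hF hFB hoqp hop hoq hpq.symm hp3 hq3 hopES hoqES hA₁d hA₂d hfacts.1 hfacts.2).1
        (pathGadget_moveGen hop hoq hpq h₁ h₂ hS hd hn₁ hn₂ hF hFB hoqp hop hoq hpq.symm hp3 hq3 hopES hoqES hA₁d hA₂d hfacts.1 hfacts.2).2
      refine finish {s(o, p)} subp hΨω hval ?_
      obtain ⟨-, hT1, -, -, -, -, -, -⟩ := generic {s(o, p)} subp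
      have hp' : s(o, p) ∉ ω ∆ (N₀ ∪ {s(o, p)}) := fun h => ((memK _ _ hopES).1 h).1 hp (mem_singleton _)
      have hq' : s(o, q) ∈ ω ∆ (N₀ ∪ {s(o, p)}) :=
        (memK _ _ hoqES).2 (iff_of_true hq fun h => hne_pq.symm (mem_singleton_iff.1 h))
      have hd' : ∀ x ∈ S3, ∀ x' ∈ S3, (openGraph ((ω ∆ (N₀ ∪ {s(o, p)})) ∩ E₁)).Reachable x x' → x = x' := by
        rw [hT1]; exact hA₁d
      rw [hΨ (ω ∆ (N₀ ∪ {s(o, p)})), if_neg hp', if_pos hq', if_pos hd']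
  · -- `op ∈ A`, `oq ∈ B`
    have hqB : s(o, q) ∈ ω ∆ M' := hgqB.2 hq
    have nA₁op : ¬ (openGraph A₁).Reachable o p := ndj hF hop hp ho3 hp3 (Or.inl rfl)
    have nA₂op : ¬ (openGraph A₂).Reachable o p := ndj hF hop hp ho3 hp3 (Or.inr rfl)
    have nB₁oq : ¬ (openGraph B₁).Reachable o q := ndj hFB hoq hqB ho3 hq3 (Or.inl rfl)
    have nB₂oq : ¬ (openGraph B₂).Reachable o q := ndj hFB hoq hqB ho3 hq3 (Or.inr rfl)
    by_cases hc : ∀ x ∈ S3, ∀ x' ∈ S3, (openGraph (ω ∩ E₁)).Reachable x x' → x = x'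
    · -- `A₁` discrete: `B₁` joins, so `B₂` is discrete, so `A₂` joins; `oq` moves INTO `A`
      have hΨω : Ψ ω = ω ∆ (N₀ ∪ {s(o, q)}) := by rw [hΨ ω, if_pos hp, if_neg hq, if_pos hc]
      have hB₁n : ¬ ∀ x ∈ S3, ∀ x' ∈ S3, (openGraph B₁).Reachable x x' → x = x' := fun h => hR₁ (agree hc h)
      obtain ⟨x, hx, x', hx', hxx', hB₁j⟩ := nondisc hB₁n
      have hB₂d : ∀ r ∈ S3, ∀ r' ∈ S3, (openGraph B₂).Reachable r r' → r = r' := by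
        intro r hr r' hr' hrr'
        by_contra hne
        exact three hFB hx hx' hr hr' hxx' hne hB₁j hrr' _ hoqES hqB
      have sA : (ω ∆ {s(o, q)}) ∩ ES ⊆ ES := inter_subset_right
      have sB : ((ω ∆ M') ∆ {s(o, q)}) ∩ ES ⊆ (∅ : Set (Sym2 V)) := by
        rintro g ⟨hg, hgES⟩
        rcases memES g hgES with rfl | rfl
        · exact (hgpB.1 ((mem_symmDiff_iff_of_notMem fun h => hne_pq (mem_singleton_iff.1 h)).1 hg)) hp
        · exact ((mem_symmDiff_iff_of_mem (mem_singleton _)).1 hg) hqB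
      have hm := pathGadget_moveFull hop hoq hpq h₁ h₂ hS hd hn₁ hn₂ (X := ω) (Y := ω ∆ M') (c := p) (c' := q) hF hFB rfl hop hoq hpq hp3 hq3 hc hB₂d nA₂op nB₁oq
        (fun h => hnRes (Or.inl h))
      have hval := isForestCfg_toggle_of_glued hM'sub hωsub hES₁ hES₂ hd {s(o, q)} subq sA sB hm.1 hm.2
      refine finish {s(o, q)} subq hΨω hval ?_
      obtain ⟨-, -, -, hT3, hT4, -, -, -⟩ := generic {s(o, q)} subq
      have hp' : s(o, p) ∈ ω ∆ (N₀ ∪ {s(o, q)}) := (memK _ _ hopES).2 (iff_of_true hp fun h => hne_pq (mem_singleton_iff.1 h))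
      have hq' : s(o, q) ∈ ω ∆ (N₀ ∪ {s(o, q)}) := (memK _ _ hoqES).2 ⟨fun h => absurd h hq, fun h => absurd (mem_singleton _) h⟩
      have hc' : ¬ (openGraph (((ω ∆ (N₀ ∪ {s(o, q)})) ∆ M') ∩ E₁)).Reachable o q ∧
          ¬ (openGraph (((ω ∆ (N₀ ∪ {s(o, q)})) ∆ M') ∩ E₂)).Reachable o p := by
        rw [hT3, hT4]; exact ⟨nB₁oq, nA₂op⟩
      rw [hΨ (ω ∆ (N₀ ∪ {s(o, q)})), if_pos hp', if_pos hq', if_pos hc']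
    · -- `A₁` joins: `A₂` discrete, `B₂` joins, `B₁` discrete; `op` moves OUT of `A`
      have hΨω : Ψ ω = ω ∆ (N₀ ∪ {s(o, p)}) := by rw [hΨ ω, if_pos hp, if_neg hq, if_neg hc]
      obtain ⟨x, hx, x', hx', hxx', hA₁j⟩ := nondisc hc
      have hA₂d : ∀ r ∈ S3, ∀ r' ∈ S3, (openGraph A₂).Reachable r r' → r = r' := by
        intro r hr r' hr' hrr'
        by_contra hne
        exact three hF hx hx' hr hr' hxx' hne hA₁j hrr' _ hopES hp
      have hB₂n : ¬ ∀ r ∈ S3, ∀ r' ∈ S3, (openGraph B₂).Reachable r r' → r = r' :=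
        fun h => hR₂ (agree hA₂d h)
      obtain ⟨r, hr, r', hr', hrr', hB₂j⟩ := nondisc hB₂n
      have hB₁d : ∀ z ∈ S3, ∀ z' ∈ S3, (openGraph B₁).Reachable z z' → z = z' := by
        intro z hz z' hz' hzz'
        by_contra hne
        exact three hFB hz hz' hr hr' hne hrr' hzz' hB₂j _ hoqES hqB
      have sA : (ω ∆ {s(o, p)}) ∩ ES ⊆ (∅ : Set (Sym2 V)) := by
        rintro g ⟨hg, hgES⟩
        rcases memES g hgES with rfl | rfl
        · exact ((mem_symmDiff_iff_of_mem (mem_singleton _)).1 hg) hp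
        · exact hq ((mem_symmDiff_iff_of_notMem fun h => hne_pq.symm (mem_singleton_iff.1 h)).1 hg)
      have sB : ((ω ∆ M') ∆ {s(o, p)}) ∩ ES ⊆ ES := inter_subset_right
      have hm := pathGadget_moveFull hop hoq hpq h₁ h₂ hS hd hn₁ hn₂ (X := ω ∆ M') (Y := ω) (c := q) (c' := p) hFB hF hoqp hoq hop hpq.symm hq3 hp3 hB₁d hA₂d nB₂oq
        nA₁op (fun h => hnRes (Or.inr ⟨h.2.symm, h.1.symm⟩))
      have hval := isForestCfg_toggle_of_glued hM'sub hωsub hES₁ hES₂ hd {s(o, p)} subp sA sB hm.2 hm.1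
      refine finish {s(o, p)} subp hΨω hval ?_
      obtain ⟨-, hT1, hT2, -, -, -, -, -⟩ := generic {s(o, p)} subp
      have hp' : s(o, p) ∉ ω ∆ (N₀ ∪ {s(o, p)}) := fun h => ((memK _ _ hopES).1 h).1 hp (mem_singleton _)
      have hq' : s(o, q) ∉ ω ∆ (N₀ ∪ {s(o, p)}) := fun h =>
        hq (((memK _ _ hoqES).1 h).2 fun h' => hne_pq.symm (mem_singleton_iff.1 h'))
      have hc' : ¬ (openGraph ((ω ∆ (N₀ ∪ {s(o, p)})) ∩ E₁)).Reachable o p ∧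
          ¬ (openGraph ((ω ∆ (N₀ ∪ {s(o, p)})) ∩ E₂)).Reachable o q := by
        rw [hT1, hT2]; exact ⟨nA₁op, nB₂oq⟩
      rw [hΨ (ω ∆ (N₀ ∪ {s(o, p)})), if_neg hp', if_neg hq', if_pos hc']
end PathGadget

end FK

end Summit.CriticalPhenomena.PercolationContinuityZ3.Theorems

end
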